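import Summits.CriticalPhenomena.SAWScalingLimit.Theorems.SAWLeftRightFKGLeftRightFKGDefs
import Summits.CriticalPhenomena.SAWScalingLimit.Theorems.SAWTotalPositivityBoundaryTP2Defs
import HarnessLib

/-!
# Vocabulary for the reduction `CornerCritical ⟸ InterlacedTP2At x_c` (crux `LeftRightFKG`, stmt-CriticalPhenomena-11232)

Line `corner-localisation`, lead c1 (prover-line-stmt-CriticalPhenomena-11232-c1-0, 2026-08-16). Lead 0 landed
`CornerLoc.stub_reduction : CornerCritical → LeftRightFKG` (`…Reduction.lean`, p98583), so the crux is exactly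
`CornerCritical`: corner positivity at `x_c` of every prefix/suffix class of every crux instance. This file is the
SHARED VOCABULARY of the lead's reshape of that one remaining stub into a provable reduction plus the core of the
sibling crux `BoundaryTP2` (stmt-CriticalPhenomena-7115): each `2 × 2` corner minor of a class is a TP₂ minor of the
self-avoiding path kernel (`BoundaryTP2.pathKernel`) of the FREE GRAPH of the class — the domain graph with the
prefix, the suffix and the two marked points deleted — for the quadruple `(u, w, w', u')` of end-steps, and its
crossed pairing is interlaced; so `BoundaryTP2.InterlacedTP2At x_c` (the interlacing-only boundary TP₂ of the
critical SAW kernel, `…SAWTotalPositivityBoundaryTP2Defs`) signs it.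

Contents (namespace `Summit.CriticalPhenomena.SAWScalingLimit.Theorems.LeftRightFKG.CornerLoc`):
* `FreeMeet k m γ₁ γ₂` — the free middles of two chords share a vertex (the negation is the hypothesis of the
  landed lens dichotomy `stub_lensDichotomy`);
* `fixedSet k π m σ`, `freeGraph Ω δ k π m σ` (same vertex type `Site 2`), `dirSet k π m σ u w` (chords of the
  class with next step `u` and previous step `w`);
* the statements of the reshaped line's stubs as PREDICATES (hypothesis names with a parameter — the instance
  data or the fugacity — so that the gate does not mistake them for literature facts; each is witnessed by a
  `stub_*` theorem in its own file): `ClassDictionaryAt Ω δ a b` (chords of a class with end-steps `(u, w)` ≃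
  paths `u → w` of the free graph), `AllMeetProportionalAt x` (Menger: if all paths from `u` and from `u'` to a
  target set meet pairwise, the two kernel rows are proportional), `CornerQuadrupleTP2At x` (the TP₂ inequality
  for corner quadruples including the endpoint-coincidence cases; the stub derives it from
  `BoundaryTP2.InterlacedTP2At x`). The OPEN core is referred to by its own name,
  `BoundaryTP2.InterlacedTP2At SAW.criticalFugacity` (sibling crux stmt-CriticalPhenomena-7115);
* small closed lemmas: `freeGraph_adj`, `freeGraph_le_domain`, `freeGraph_le`, `not_mem_support_freeGraph`,
  `support_freeGraph_finite`, `mem_dirSet`, and the registered sub-goal `stub_freeGraphBasic`.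
-/

noncomputable section

open MeasureTheory
open Literature.Probability.LatticeModels Literature.Probability.RandomPlanarGeometry
open scoped Classical ENNReal

namespace Summit.CriticalPhenomena.SAWScalingLimit.Theorems.LeftRightFKG.CornerLoc

/-! ## Vocabulary -/

section Vocabulary

variable {Ω : Set ℂ} {δ : ℝ} {a b : Site 2}

/-- The FREE MIDDLES of two chords of a prefix/suffix class `cls k π m σ` MEET: some vertex at a free position of
`γ₁` (strictly between the prefix end `k` and the suffix start `|γ₁| - m`) is a vertex at a free position of `γ₂`.
Its negation is verbatim the disjointness hypothesis of the landed lens dichotomy. [folklore] -/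
def FreeMeet (k m : ℕ) (γ₁ γ₂ : SAW.DomainSAW Ω δ a b) : Prop :=
  ∃ i j : ℕ, k < i ∧ i + m < γ₁.length ∧ k < j ∧ j + m < γ₂.length ∧
    γ₁.walk.getVert i = γ₂.walk.getVert j

/-- The FIXED vertices of a class: the prefix `π 0, …, π k` and the suffix `σ 0, …, σ m` (so `π k` and `σ m`,
the two marked points of the slit sub-instance, are fixed). [folklore] -/
def fixedSet (k : ℕ) (π : ℕ → Site 2) (m : ℕ) (σ : ℕ → Site 2) : Set (Site 2) :=
  {v | (∃ i, i ≤ k ∧ π i = v) ∨ ∃ j, j ≤ m ∧ σ j = v}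

/-- The FREE GRAPH of a class: the discrete domain graph `Ω_δ` with every fixed vertex isolated (same vertex
type; an edge survives iff both ends are free). The free middles of the chords of the class are exactly its
self-avoiding paths between neighbours of the two marked points (`ClassDictionary`). [folklore] -/
def freeGraph (Ω : Set ℂ) (δ : ℝ) (k : ℕ) (π : ℕ → Site 2) (m : ℕ) (σ : ℕ → Site 2) :
    SimpleGraph (Site 2) where
  Adj v w := (discreteDomainGraph Ω δ).Adj v w ∧ v ∉ fixedSet k π m σ ∧ w ∉ fixedSet k π m σ
  symm := ⟨fun _ _ h => ⟨h.1.symm, h.2.2, h.2.1⟩⟩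
  loopless := ⟨fun _ h => h.1.ne rfl⟩

/-- The DIRECTION CLASS `(u, w)`: chords of `cls k π m σ` whose next step (vertex `k + 1`) is `u` and whose
previous step (vertex `m + 1` from the end) is `w` — one entry of the end-step matrix. [folklore] -/
def dirSet (k : ℕ) (π : ℕ → Site 2) (m : ℕ) (σ : ℕ → Site 2) (u w : Site 2) :
    Set (SAW.DomainSAW Ω δ a b) :=
  {γ | γ ∈ cls k π m σ ∧ γ.walk.getVert (k + 1) = u ∧ γ.walk.reverse.getVert (m + 1) = w}

/-- Adjacency in the free graph, unfolded. [folklore] -/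
@[simp] theorem freeGraph_adj {k : ℕ} {π : ℕ → Site 2} {m : ℕ} {σ : ℕ → Site 2} {v w : Site 2} :
    (freeGraph Ω δ k π m σ).Adj v w ↔
      (discreteDomainGraph Ω δ).Adj v w ∧ v ∉ fixedSet k π m σ ∧ w ∉ fixedSet k π m σ :=
  Iff.rfl

/-- The free graph is a subgraph of the domain graph. [folklore] -/
theorem freeGraph_le_domain (k : ℕ) (π : ℕ → Site 2) (m : ℕ) (σ : ℕ → Site 2) :
    freeGraph Ω δ k π m σ ≤ discreteDomainGraph Ω δ :=
  fun _ _ h => h.1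

/-- The free graph is a subgraph of `ℤ²`. [folklore] -/
theorem freeGraph_le (k : ℕ) (π : ℕ → Site 2) (m : ℕ) (σ : ℕ → Site 2) :
    freeGraph Ω δ k π m σ ≤ zdGraph 2 :=
  fun _ _ h => meshGraph_le_zdGraph Ω δ (discreteDomainGraph_le_meshGraph Ω δ h.1)

/-- Fixed vertices are isolated in the free graph. [folklore] -/
theorem not_mem_support_freeGraph {k : ℕ} {π : ℕ → Site 2} {m : ℕ} {σ : ℕ → Site 2} {v : Site 2}
    (hv : v ∈ fixedSet k π m σ) : v ∉ (freeGraph Ω δ k π m σ).support := by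
  rintro ⟨w, hw⟩
  exact hw.2.1 hv

/-- Non-isolated vertices of the free graph are sites of the discrete domain. [folklore] -/
theorem support_freeGraph_subset (k : ℕ) (π : ℕ → Site 2) (m : ℕ) (σ : ℕ → Site 2) :
    (freeGraph Ω δ k π m σ).support ⊆ meshDomain Ω δ := by
  rintro v ⟨w, hw⟩
  exact (discreteDomainGraph_adj_iff.1 hw.1).2.1

/-- For a bounded domain and a positive mesh the free graph has finitely many non-isolated vertices. [folklore] -/
theorem support_freeGraph_finite (hΩ : Bornology.IsBounded Ω) (hδ : 0 < δ) (k : ℕ) (π : ℕ → Site 2) (m : ℕ)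
    (σ : ℕ → Site 2) : (freeGraph Ω δ k π m σ).support.Finite :=
  (meshDomain_finite hΩ hδ).subset (support_freeGraph_subset k π m σ)

/-- Membership in a direction class, unfolded. [folklore] -/
@[simp] theorem mem_dirSet {k : ℕ} {π : ℕ → Site 2} {m : ℕ} {σ : ℕ → Site 2} {u w : Site 2}
    {γ : SAW.DomainSAW Ω δ a b} :
    γ ∈ dirSet k π m σ u w ↔ γ ∈ cls k π m σ ∧ γ.walk.getVert (k + 1) = u ∧ γ.walk.reverse.getVert (m + 1) = w :=
  Iff.rfl

/-- A direction class is contained in its prefix/suffix class. [folklore] -/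
theorem dirSet_subset_cls (k : ℕ) (π : ℕ → Site 2) (m : ℕ) (σ : ℕ → Site 2) (u w : Site 2) :
    (dirSet k π m σ u w : Set (SAW.DomainSAW Ω δ a b)) ⊆ cls k π m σ :=
  fun _ h => h.1

end Vocabulary

/-! ## Statements of the reshaped line's stubs (hypothesis names) -/

/-- CLASS DICTIONARY for the chord type `(Ω, δ, a, b)` — predicate witnessed (for all data) by the registered
stub `stub_classDictionary`: in a class with two distinct chords (so that prefix and suffix are genuine, disjoint
lattice paths), for free `u ∼ π k` and free `w ∼ σ m` the chords with next step `u` and previous step `w`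
correspond bijectively to the self-avoiding paths `u → w` of the free graph (the free middle), lengths dropping by
`k + m + 2`, the vertices of the path being exactly the vertices of the chord at free positions. The degenerate
`u = w` (free middle a single vertex, the trivial path) is included. [folklore] -/
def ClassDictionaryAt (Ω : Set ℂ) (δ : ℝ) (a b : Site 2) : Prop :=
  ∀ (k : ℕ) (π : ℕ → Site 2) (m : ℕ) (σ : ℕ → Site 2),
    (∃ γ₁ γ₂ : SAW.DomainSAW Ω δ a b, γ₁ ∈ cls k π m σ ∧ γ₂ ∈ cls k π m σ ∧ γ₁ ≠ γ₂) →
    ∀ u w : Site 2, u ∉ fixedSet k π m σ → w ∉ fixedSet k π m σ →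
      (discreteDomainGraph Ω δ).Adj (π k) u → (discreteDomainGraph Ω δ).Adj w (σ m) →
      ∃ e : {γ : SAW.DomainSAW Ω δ a b // γ ∈ dirSet k π m σ u w} ≃ (freeGraph Ω δ k π m σ).Path u w,
        (∀ γ, (e γ).1.length + (k + m + 2) = γ.1.length) ∧
        (∀ γ, ∀ v : Site 2, v ∈ (e γ).1.support ↔
          ∃ i : ℕ, k < i ∧ i + m < γ.1.length ∧ γ.1.walk.getVert i = v)

/-- ALL-MEET ⇒ PROPORTIONAL ROWS at fugacity `x` — predicate witnessed (for all `x > 0`) by the registered stub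
`stub_allMeetProportional` (pure graph theory): if every self-avoiding path from `u` to the target set `T` shares a
vertex with every self-avoiding path from `u' ≠ u` to `T`, then the kernel rows of `u` and `u'` restricted to `T`
are proportional: `Z(u,w) Z(u',w') = Z(u,w') Z(u',w)` for `w, w' ∈ T`. Content: Menger's theorem for two paths
(`Literature.Combinatorics.SimpleGraph.exists_mem_support_forall`, `S = {u,u'}`) gives one vertex on every
`{u,u'}`–`T` walk, and the cut-vertex factorisation of the path kernel (`BoundaryTP2.stub_cutVertex_factor`)
factors both rows through it. [cite: Diestel2017, Thm. 3.3.1] -/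
def AllMeetProportionalAt (x : ℝ) : Prop :=
  ∀ (H : SimpleGraph (Site 2)), H.support.Finite →
    ∀ (u u' : Site 2) (T : Set (Site 2)), u ≠ u' →
      (∀ (w w' : Site 2) (P : H.Path u w) (Q : H.Path u' w'), w ∈ T → w' ∈ T →
        ∃ v, v ∈ P.1.support ∧ v ∈ Q.1.support) →
      ∀ w w' : Site 2, w ∈ T → w' ∈ T →
        BoundaryTP2.pathKernel H x u w * BoundaryTP2.pathKernel H x u' w' =
          BoundaryTP2.pathKernel H x u w' * BoundaryTP2.pathKernel H x u' w

/-- CORNER QUADRUPLE TP₂ at fugacity `x` — predicate witnessed (for all `x > 0`, from `BoundaryTP2.InterlacedTP2At x`)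
by the registered stub `stub_cornerQuadruple`: for every CORNER QUADRUPLE `(u, w, w', u')` of a finite subgraph
`H ≤ ℤ²` — `u ≠ u'` lattice neighbours of a vertex `p` isolated in `H`, `w ≠ w'` lattice neighbours of a vertex
`q ≠ p` isolated in `H`, the crossed pairing `(u → w', w → u')` interlaced — the crossed product is at most the
nested one. The interlacing-only TP₂ is stated for pairwise distinct quadruples; the coincidences `u = w'`, `u' = w`
are free (every path of the other crossed class passes through the common vertex: sub-multiplicativity),
`u = w` / `u' = w'` are its instances on `H` with the pendant edge `p u` / `q u'` added (trivially interlaced),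
`u = w ∧ u' = w'` the instance with both pendants (`Z_H(u,u') ≤ 1`). [folklore] -/
def CornerQuadrupleTP2At (x : ℝ) : Prop :=
  ∀ (H : SimpleGraph (Site 2)), H ≤ zdGraph 2 → H.support.Finite →
    ∀ p q u u' w w' : Site 2, p ≠ q → p ∉ H.support → q ∉ H.support →
      (zdGraph 2).Adj p u → (zdGraph 2).Adj p u' → (zdGraph 2).Adj q w → (zdGraph 2).Adj q w' →
      u ≠ u' → w ≠ w' → p ≠ w → p ≠ w' → q ≠ u → q ≠ u' →
      BoundaryTP2.Interlaced H u w w' u' →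
      BoundaryTP2.pathKernel H x u w' * BoundaryTP2.pathKernel H x w u' ≤
        BoundaryTP2.pathKernel H x u w * BoundaryTP2.pathKernel H x w' u'

/-! ## Registered sub-goal carried by this vocabulary file -/

/-- REGISTERED SUB-GOAL `stub_freeGraphBasic` (recorded on the crux item so that this vocabulary file lands as a
`--supports` proof): the free graph of every class of every crux domain is a subgraph of `ℤ²` with finitely many
non-isolated vertices in which the two marked points `π k`, `σ m` are isolated — the side conditions under which
`InterlacedTP2At` / `CornerQuadrupleTP2` are invoked. [folklore] -/
theorem stub_freeGraphBasic : ∀ (δ : ℝ) (c : Site 2) (C : (zdGraph 2).Walk c c) (k : ℕ) (π : ℕ → Site 2)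
    (m : ℕ) (σ : ℕ → Site 2), 0 < δ →
    freeGraph (dom C δ) δ k π m σ ≤ zdGraph 2 ∧ (freeGraph (dom C δ) δ k π m σ).support.Finite ∧
      π k ∉ (freeGraph (dom C δ) δ k π m σ).support ∧ σ m ∉ (freeGraph (dom C δ) δ k π m σ).support :=
  fun δ _ C k π m σ hδ =>
    ⟨freeGraph_le k π m σ, support_freeGraph_finite (isBounded_dom C δ) hδ k π m σ,
      not_mem_support_freeGraph (Or.inl ⟨k, le_rfl, rfl⟩), not_mem_support_freeGraph (Or.inr ⟨m, le_rfl, rfl⟩)⟩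

end Summit.CriticalPhenomena.SAWScalingLimit.Theorems.LeftRightFKG.CornerLoc

end
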